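import Mathlib
import Summits.ValiantsHypothesis.ValiantsHypothesis.Theorems.LiouvilleSarnakLiouvilleCutRankCompactness
import Summits.ValiantsHypothesis.ValiantsHypothesis.Theorems.LiouvilleSarnakLiouvilleCutRankInfiniteWords

/-!
# Route LiouvilleSarnak — crux `LiouvilleCutRank` (stmt-ValiantsHypothesis-14775):
# reduction of the crux to "long run anywhere" + "infinitely many rows for every bounded-run infinite word"

Sequel to `Theorems/LiouvilleSarnakLiouvilleCutRankInfiniteWords.lean` (the infinite Liouville cut matrix
`A_t(X, Y) = λ(N_t(X,Y) + 1)` of an infinite cut word `t : ℕ → Bool`, `N_t(X,Y) = Σ_{i∈X, t i} 2^i +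
Σ_{i∈Y, ¬t i} 2^i`, written inline) and `…Compactness.lean` (Kőnig: the crux follows from forcing prefixes).

* ★★ `forcing_of_infiniteRows` — if `A_t` has infinitely many distinct rows then `t` has a forcing prefix for
  every `W`: `2^W` distinct rows are pairwise separated at finitely many columns; beyond all positions involved,
  the unbalanced window embedding `…InfiniteWords.card_truncRows_le_two_pow_rank` gives `2^W ≤ 2^{rank M_π}` for
  every balanced cut `π` (any level) whose word contains that prefix as a window.
* ★★★ `liouvilleCutRank_of_longRun_of_infiniteRows` — **`LiouvilleCutRank` follows from
  (a) LONG RUN ANYWHERE: for every `W` a run length `L` such that every balanced cut whose row/column word has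
  `L` consecutive equal letters anywhere has rank `≥ W` (finite-level; OPEN — the tree's
  `…LongRun.le_rank_of_longRun` needs the run to fill almost half of a balanced window), and
  (b) INFINITELY MANY ROWS FOR BOUNDED-RUN WORDS: for every `L` and every infinite word `t` with no `L`
  consecutive equal letters, `A_t` has infinitely many distinct rows (infinite-level; OPEN — by
  `…InfiniteWords.orbitRigidity_infiniteWord` a counterexample is rigid along its whole shift orbit; known for
  `(CR)^∞`, `(CCRR)^∞`, `(CRRC)^∞` and the periodic words with a ratio certificate, `…PeriodicRatio`).**

Honest framing: a reduction; `LiouvilleCutRank`, `DigitalBilinearLiouville`, `AlgebraicSarnak` stay OPEN;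
nothing here bears on `VP ≠ VNP`.  No definitions.
-/

set_option linter.dupNamespace false

namespace Summit.ValiantsHypothesis.ValiantsHypothesis.Theorems.LiouvilleSarnakLiouvilleCutRank.InfiniteWordsReduction

open ArithmeticFunction Finset

open Summit.ValiantsHypothesis.ValiantsHypothesis.Theorems.LiouvilleSarnakLiouvilleCutRank.InfiniteWords
  (card_truncRows_le_two_pow_rank)
open Summit.ValiantsHypothesis.ValiantsHypothesis.Theorems.LiouvilleSarnakLiouvilleCutRank.Compactness
  (liouvilleCutRank_of_longRun_of_boundedRun)
open Summit.ValiantsHypothesis.ValiantsHypothesis.Theses.LiouvilleSarnak (LiouvilleCutRank)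

/-! ### Forcing prefixes from infinitely many rows; the reduction of the crux -/

/-- ★★ **Infinitely many rows force.**  If the infinite Liouville cut matrix `A_t` of `t` has infinitely
many distinct rows, then for every `W` some prefix of `t` forces rank `≥ W`: every balanced cut (any level)
whose row/column word contains `t 0, …, t (m-1)` as a window has rank `≥ W`.  (`2^W` distinct rows are
pairwise separated at finitely many columns; take `m` beyond all row and column positions involved and
apply `…InfiniteWords.card_truncRows_le_two_pow_rank`.) [this file] -/
theorem forcing_of_infiniteRows (t : ℕ → Bool)
    (hinf : (Set.range fun X Y : Finset ℕ =>
      liouville ((∑ i ∈ X, (if t i then 2 ^ i else 0)) +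
        (∑ i ∈ Y, (if t i then 0 else 2 ^ i)) + 1)).Infinite) (W : ℕ) :
    ∃ m : ℕ, ∀ (n : ℕ) (π : Fin n ⊕ Fin n ≃ Fin (2 * n)) (w : ℕ → Bool) (s : ℕ),
      (∀ j : Fin (2 * n), w j = (π.symm j).isLeft) → s + m ≤ 2 * n →
      (∀ k < m, w (s + k) = t k) →
      W ≤ (Matrix.of fun r c : Fin n → Bool =>
        (((liouville (Nat.ofBits (fun j : Fin (2 * n) => Sum.elim r c (π.symm j)) + 1) : ℤ) :
          ℂ))).rank := by
  classical
  set A : Finset ℕ → Finset ℕ → ℤ := fun X Y =>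
    liouville ((∑ i ∈ X, (if t i then 2 ^ i else 0)) +
      (∑ i ∈ Y, (if t i then 0 else 2 ^ i)) + 1) with hA
  obtain ⟨S, hS, hcard⟩ := hinf.exists_subset_card_eq (2 ^ W)
  -- row indices and separating columns
  have hX : ∀ f ∈ S, ∃ X : Finset ℕ, A X = f := fun f hf => hS hf
  choose! Xf hXf using hX
  have hY : ∀ f ∈ S, ∀ g ∈ S, f ≠ g → ∃ Y : Finset ℕ, f Y ≠ g Y := fun f _ g _ hfg =>
    Function.ne_iff.mp hfg
  -- a uniform separating family (junk value where `f = g`)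
  have hY' : ∀ f g : Finset ℕ → ℤ, ∃ Y : Finset ℕ, (f ∈ S → g ∈ S → f ≠ g → f Y ≠ g Y) := by
    intro f g
    by_cases h : f ∈ S ∧ g ∈ S ∧ f ≠ g
    · obtain ⟨Y, hY⟩ := hY f h.1 g h.2.1 h.2.2
      exact ⟨Y, fun _ _ _ => hY⟩
    · exact ⟨∅, fun hf hg hfg => (h ⟨hf, hg, hfg⟩).elim⟩
  choose Yfg hYfg using hY'
  -- the truncation level
  set m : ℕ := (S.sup fun f => (Xf f).sup id + 1) ⊔ (S.sup fun f => S.sup fun g => (Yfg f g).sup id + 1)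
    with hm
  have hXm : ∀ f ∈ S, Xf f ⊆ range m := by
    intro f hf i hi
    rw [Finset.mem_range]
    have h1 : i ≤ (Xf f).sup id := Finset.le_sup (f := id) hi
    have h2 : (Xf f).sup id + 1 ≤ S.sup fun f => (Xf f).sup id + 1 :=
      Finset.le_sup (f := fun f => (Xf f).sup id + 1) hf
    have h3 : (S.sup fun f => (Xf f).sup id + 1) ≤ m := le_sup_left
    omega
  have hYm : ∀ f ∈ S, ∀ g ∈ S, Yfg f g ⊆ range m := by
    intro f hf g hg i hi
    rw [Finset.mem_range]
    have h1 : i ≤ (Yfg f g).sup id := Finset.le_sup (f := id) hi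
    have h2 : (Yfg f g).sup id + 1 ≤ S.sup fun g => (Yfg f g).sup id + 1 :=
      Finset.le_sup (f := fun g => (Yfg f g).sup id + 1) hg
    have h3 : (S.sup fun g => (Yfg f g).sup id + 1) ≤
        S.sup fun f => S.sup fun g => (Yfg f g).sup id + 1 :=
      Finset.le_sup (f := fun f => S.sup fun g => (Yfg f g).sup id + 1) hf
    have h4 : (S.sup fun f => S.sup fun g => (Yfg f g).sup id + 1) ≤ m := le_sup_right
    omega
  refine ⟨m, fun n π w s hw hs htw => ?_⟩
  -- the truncated rows of the `Xf f`, `f ∈ S`, are pairwise distinct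
  set F : Finset ℕ → Finset ℕ → ℤ := fun X Y =>
    liouville ((∑ i ∈ X, (if t i then 2 ^ i else 0)) +
      (∑ i ∈ Y ∩ range m, (if t i then 0 else 2 ^ i)) + 1) with hF
  have hFA : ∀ X Y : Finset ℕ, Y ⊆ range m → F X Y = A X Y := by
    intro X Y hY
    simp only [hF, hA, Finset.inter_eq_left.mpr hY]
  have hinj : Set.InjOn (fun f => F (Xf f)) ↑S := by
    intro f hf g hg hfg
    by_contra hne
    have hsep := hYfg f g hf hg hne
    apply hsep
    have h1 : F (Xf f) (Yfg f g) = F (Xf g) (Yfg f g) := by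
      simpa using congrFun hfg (Yfg f g)
    rw [hFA _ _ (hYm f hf g hg), hFA _ _ (hYm f hf g hg), hXf f hf, hXf g hg] at h1
    exact h1
  have hmaps : ∀ f ∈ S, (fun f => F (Xf f)) f ∈ (range m).powerset.image F := fun f hf =>
    Finset.mem_image.mpr ⟨Xf f, Finset.mem_powerset.mpr (hXm f hf), rfl⟩
  have hle : 2 ^ W ≤ ((range m).powerset.image F).card := by
    rw [← hcard]
    exact Finset.card_le_card_of_injOn _ hmaps hinj
  have hemb := card_truncRows_le_two_pow_rank t m n π w hw s hs htw
  exact (pow_le_pow_iff_right₀ (by norm_num : (1 : ℕ) < 2)).mp (hle.trans hemb)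

/-- ★★★ **The reduction.**  `LiouvilleCutRank` follows from
(a) *long run anywhere*: for every `W` a run length `L` such that every balanced cut whose row/column word
has `L` consecutive equal letters anywhere has rank `≥ W` (finite-level; OPEN), and
(b) *infinitely many rows for bounded-run words*: for every `L` and every infinite word `t` with no `L`
consecutive equal letters, the infinite Liouville cut matrix `A_t` has infinitely many distinct rows
(infinite-level; OPEN — by `orbitRigidity_infiniteWord` a counterexample is rigid along its whole shift
orbit; known for the periodic words with a ratio certificate).
(`…Compactness.liouvilleCutRank_of_longRun_of_boundedRun` + `forcing_of_infiniteRows`.) [this file] -/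
theorem liouvilleCutRank_of_longRun_of_infiniteRows
    (hrun : ∀ W : ℕ, ∃ L : ℕ,
      ∀ (n : ℕ) (π : Fin n ⊕ Fin n ≃ Fin (2 * n)) (w : ℕ → Bool) (s : ℕ),
        (∀ j : Fin (2 * n), w j = (π.symm j).isLeft) → s + L ≤ 2 * n →
        (∀ k < L, w (s + k) = w s) →
        W ≤ (Matrix.of fun r c : Fin n → Bool =>
          (((liouville (Nat.ofBits (fun j : Fin (2 * n) => Sum.elim r c (π.symm j)) + 1) : ℤ) :
            ℂ))).rank)
    (hrows : ∀ (L : ℕ) (t : ℕ → Bool), (∀ i : ℕ, ∃ j : ℕ, i < j ∧ j < i + L ∧ t j ≠ t i) →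
      (Set.range fun X Y : Finset ℕ =>
        liouville ((∑ i ∈ X, (if t i then 2 ^ i else 0)) +
          (∑ i ∈ Y, (if t i then 0 else 2 ^ i)) + 1)).Infinite) :
    LiouvilleCutRank :=
  liouvilleCutRank_of_longRun_of_boundedRun hrun fun W L t ht => forcing_of_infiniteRows t (hrows L t ht) W

end Summit.ValiantsHypothesis.ValiantsHypothesis.Theorems.LiouvilleSarnakLiouvilleCutRank.InfiniteWordsReduction
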